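import Summits.PneNP.PneNP.Theorems.SfmBlMachineHat
import Summits.PneNP.PneNP.Theorems.SfmBlMachineTrace
import Summits.PneNP.PneNP.Theorems.Sd2BlMachineRawLegs
import Summits.PneNP.PneNP.Theorems.Sd2BlMachineParams

/-!
# Sign-degree-2 engine, MACHINE LAYER G5: constants, static data and the greedy signing loop (cell pnp-ideate,
# ROUND-18 item K1'' `SignDeg2Signing.SignDeg2SigningFP`, stage S3)

FRONTIER (range avoidance for sign-degree-≤2 local maps at linear stretch; restricted-model algorithmic
rung); nothing here bears on P vs NP.

The SPEC of the whole sign-degree-2 machine as plain (list) functions, twin of `SfmBlMachineGreedy` (pure CAND)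
with (i) the constants of the parametric pipeline `Sd2Bl.legBound_of_pipeline` as FUNCTIONS of the legs-per-output
`ℓ` and the size exponent `t` (`Sd2BlNumerics`): block length `gL t = 4^t`, bad threshold² `gG = 34ℓ·L·s`
(`s = 2t`), extraction threshold² `gRsq = 544ℓ³·L·s` (`= (4ℓ·γ_b)²`), radius `gRad = 2400ℓ²s(s+1)2^t`;
(ii) a generic pieced-leg list `plegs` (G1 `pieceLegsG` on the raw legs of G2 `rawLegs`) instead of triples;
(iii) the parameters of G3 (`pT0'`, `pQ1'` with the doubled `t₀` condition) and the caps `(40N)^(4t+1)` (walks),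
`|plegs|·(40N)^(8t)` (alternating sequences), `40N` (sublists); (iv) the integer weights of the ONE comparison
`C₁ = 6(4V + L^10)`, `C₂ = 50·L^10·(N·R^ℓ' + 1)` (`ℓ' = 2^(j+2)`; `A₁ = 10(N·R^ℓ'+1)` is an integer,
`A₃ = 6(4V+L^10)/(5L^10)`).  The loop (`gPot`, `greedyStepP`, `greedyRunP`, `greedyBitsP`) is generic in a
potential `pot : ℕ → List Bool → ℤ`; `sd2Bits ℓ t m plegs` and the string function
`sd2Str k F0 F1 F2 ℓ t` (decode with prover-1's `LocalMapDecodeFP.decode`, `m = hdrM`) assemble the machine.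
Proved: `length_greedyBitsP`, `greedyBitsP_prefix`, `pot_greedyStepP_le`, `sd2Str_encode`.  Typing = G6.
-/

set_option linter.dupNamespace false -- `Summit.PneNP.PneNP.…`: summit = sub-problem name (D-0017 single-conjunct layout)

namespace Summit.PneNP.PneNP.Theorems.Sd2BlMachine

open Literature.Computability.Complexity
open Summit.PneNP.PneNP.Theorems.SfmBlMachine
open Summit.PneNP.PneNP.Theorems.LocalMapDecodeFP (decode hdrM decode_encode hdrM_encode)

/-! ## Constants (functions of `ℓ`, `t`) -/

/-- Block length `L = 4^t`. -/
def gL (t : ℕ) : ℕ := 2 ^ (2 * t)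

/-- `γ_b² = 34·ℓ·L·s` (`s = 2t`), the bad threshold squared. -/
def gG (ℓ t : ℕ) : ℕ := 34 * ℓ * 2 ^ (2 * t) * (2 * t)

/-- `γ_R² = 544·ℓ³·L·s = (4ℓ·γ_b)²`, the extraction / sparseness threshold squared. -/
def gRsq (ℓ t : ℕ) : ℕ := 544 * ℓ ^ 3 * 2 ^ (2 * t) * (2 * t)

/-- The radius `R = 2400·ℓ²·s·(s+1)·2^t`. -/
def gRad (ℓ t : ℕ) : ℕ := 2400 * ℓ ^ 2 * (2 * t) * (2 * t + 1) * 2 ^ t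

/-! ## Static data of `(m, plegs)` -/

/-- `N = #pieces`. -/
def gN (plegs : List PLeg) : ℕ := (pieces plegs).length

/-- The walk cap `(40N)^(4t+1)`. -/
def gCapW (t : ℕ) (plegs : List PLeg) : ℕ := (40 * gN plegs) ^ (4 * t + 1)

/-- The alternating-sequence cap `|plegs| · (40N)^(8t)`. -/
def gCapA (t : ℕ) (plegs : List PLeg) : ℕ := plegs.length * (40 * gN plegs) ^ (8 * t)

/-- The sublist cap `40N`. -/
def gCapS (plegs : List PLeg) : ℕ := 40 * gN plegs

/-- The candidate pairs, walks of length `2(t₀ − 1)`. -/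
def gCands (t : ℕ) (plegs : List PLeg) : List Cand :=
  cands plegs (gCapW t plegs) (pT0' (gN plegs)) (List.replicate (2 * (pT0' (gN plegs) - 1)) ())

/-- The extraction output `(labels, r)`, `|plegs| + 1` rounds, threshold² `γ_R²`. -/
def gExtract (ℓ t : ℕ) (plegs : List PLeg) : List ℕ × ℕ :=
  extract (gRsq ℓ t) plegs (gCands t plegs) (List.replicate (plegs.length + 1) ())

/-- The number of spots, clamped by the number of rounds (inactive). -/
def gR' (ℓ t : ℕ) (plegs : List PLeg) : ℕ := min (gExtract ℓ t plegs).2 (plegs.length + 1)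

/-- The remainder legs. -/
def gRlegs (ℓ t : ℕ) (plegs : List PLeg) : List PLeg := rlegs plegs (gExtract ℓ t plegs).1

/-- The rounds of the alternating-sequence enumeration: `2(q+1) − 1`. -/
def gUA (plegs : List PLeg) : List Unit := List.replicate (2 * pQ1' (gN plegs) - 1) ()

/-- The pair records of all spots. -/
def gRecs (ℓ t : ℕ) (plegs : List PLeg) : List PRec :=
  allRecs (gCapS plegs) (gCapW t plegs) plegs (gExtract ℓ t plegs).1 (gR' ℓ t plegs)

/-- `V = Σ_s (|V₁ s| + |V₂ s|)`. -/
def gV (ℓ t : ℕ) (plegs : List PLeg) : ℕ :=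
  ((List.range (gR' ℓ t plegs)).map fun s =>
    (lpieces (slegs plegs (gExtract ℓ t plegs).1 s)).length
      + (rpieces (slegs plegs (gExtract ℓ t plegs).1 s)).length).sum

/-- The exponent `ℓ' = 2(q+1) = 2^(j+2)` of the trace. -/
def gEll (plegs : List PLeg) : ℕ := 2 * pQ1' (gN plegs)

/-- `C₁ = 6(4V + L^10)` (weight of the trace part). -/
def gC₁ (ℓ t : ℕ) (plegs : List PLeg) : ℕ := 6 * (4 * gV ℓ t plegs + (gL t) ^ 10)

/-- `C₂ = 50·L^10·(N·R^ℓ' + 1)` (weight of the hat part). -/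
def gC₂ (ℓ t : ℕ) (plegs : List PLeg) : ℕ := 50 * (gL t) ^ 10 * (gN plegs * (gRad ℓ t) ^ gEll plegs + 1)

/-! ## The greedy loop, generic in the potential -/

/-- THE SCALED POTENTIAL of the cylinder of the prefix `T0` (length `kk`):
`C₁ · Σ_cyl tr + C₂ · Σ_cyl Σ_s ê_s`, `pw = 2^(m − kk + 1)`. -/
def gPot (ℓ t m : ℕ) (plegs : List PLeg) (kk : ℕ) (T0 : List Bool) : ℤ :=
  (gC₁ ℓ t plegs : ℤ) * traceSum kk T0 (2 ^ (m - kk + 1)) (gRlegs ℓ t plegs) (gCapA t plegs) (gUA plegs)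
    + (gC₂ ℓ t plegs : ℤ) * (hatSum (gG ℓ t) kk T0 m (gRecs ℓ t plegs) : ℤ)

/-- One greedy step for a potential `pot`: append the bit whose cylinder has the smaller potential. -/
def greedyStepP (pot : ℕ → List Bool → ℤ) (acc : List Bool) : List Bool :=
  if pot (acc.length + 1) (acc ++ [false]) ≤ pot (acc.length + 1) (acc ++ [true])
  then acc ++ [false] else acc ++ [true]

/-- The greedy run after `|u|` steps. -/
def greedyRunP (pot : ℕ → List Bool → ℤ) (u : List Unit) : List Bool :=
  u.foldl (fun acc _ => greedyStepP pot acc) []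

/-- The greedy signing: `m` steps. -/
def greedyBitsP (pot : ℕ → List Bool → ℤ) (m : ℕ) : List Bool := greedyRunP pot (List.replicate m ())

/-- **The sign-degree-2 signing** of `(m, plegs)`. -/
def sd2Bits (ℓ t m : ℕ) (plegs : List PLeg) : List Bool := greedyBitsP (gPot ℓ t m plegs) m

section Machine

variable (k : ℕ) (F0 : ((Fin k → Bool) → Bool) → ℤ) (F1 : ((Fin k → Bool) → Bool) → Fin k → ℤ)
  (F2 : ((Fin k → Bool) → Bool) → Fin k → Fin k → ℤ)

/-- **THE MACHINE**: decode, build the raw legs from the coefficient tables, block-split at `L = 4^t`, sign. -/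
noncomputable def sd2Str (ℓ t : ℕ) (w : List Bool) : List Bool :=
  sd2Bits ℓ t (hdrM w) (pieceLegsG (gL t) (rawLegs k F0 F1 F2 (decode k w)))

/-- **On the code of an instance the machine signs the block-split certificate legs.** -/
theorem sd2Str_encode (ℓ t : ℕ) {n m : ℕ} (I : LocalMap k n m) :
    sd2Str k F0 F1 F2 ℓ t I.encode = sd2Bits ℓ t m (pieceLegsG (gL t) (rawLegs k F0 F1 F2 (decode k I.encode))) := by
  rw [sd2Str, hdrM_encode]

end Machine

/-! ## The loop's invariant -/

section Loop

variable (pot : ℕ → List Bool → ℤ)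

/-- One step appends one bit. -/
theorem greedyStepP_eq_append (acc : List Bool) : ∃ b, greedyStepP pot acc = acc ++ [b] := by
  unfold greedyStepP
  split_ifs
  · exact ⟨false, rfl⟩
  · exact ⟨true, rfl⟩

/-- The run has one bit per step. -/
theorem length_greedyRunP (u : List Unit) : (greedyRunP pot u).length = u.length := by
  unfold greedyRunP
  suffices h : ∀ (u : List Unit) (acc : List Bool),
      (u.foldl (fun acc _ => greedyStepP pot acc) acc).length = acc.length + u.length by
    simpa using h u []
  intro u
  induction u with
  | nil => intro acc; simp
  | cons _ u ih =>
    intro acc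
    rw [List.foldl_cons, ih]
    obtain ⟨b, hb⟩ := greedyStepP_eq_append pot acc
    rw [hb, List.length_append, List.length_singleton, List.length_cons]; omega

/-- **The greedy signing has `m` bits.** -/
theorem length_greedyBitsP (m : ℕ) : (greedyBitsP pot m).length = m := by
  unfold greedyBitsP; rw [length_greedyRunP, List.length_replicate]

/-- More steps extend the run. -/
theorem greedyRunP_append (u v : List Unit) :
    greedyRunP pot (u ++ v) = v.foldl (fun acc _ => greedyStepP pot acc) (greedyRunP pot u) := by
  unfold greedyRunP; rw [List.foldl_append]

/-- A run is a prefix of any longer run. -/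
theorem greedyRunP_prefix :
    ∀ (v u : List Unit), (greedyRunP pot (u ++ v)).take u.length = greedyRunP pot u := by
  intro v
  induction v with
  | nil => intro u; rw [List.append_nil, ← length_greedyRunP pot u, List.take_length]
  | cons x v ih =>
    intro u
    have h := ih (u ++ [x])
    rw [List.append_assoc, List.singleton_append, List.length_append, List.length_singleton] at h
    have h2 : (greedyRunP pot (u ++ x :: v)).take u.length
        = ((greedyRunP pot (u ++ x :: v)).take (u.length + 1)).take u.length := by
      rw [List.take_take, min_eq_left (Nat.le_succ _)]
    rw [h2, h, greedyRunP_append]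
    simp only [List.foldl_cons, List.foldl_nil]
    obtain ⟨b, hb⟩ := greedyStepP_eq_append pot (greedyRunP pot u)
    rw [hb, List.take_append_of_le_length (by rw [length_greedyRunP]), ← length_greedyRunP pot u, List.take_length]

/-- **THE INVARIANT**: for `k < m`, the first `k + 1` bits are the greedy step applied to the first `k` bits. -/
theorem greedyBitsP_prefix (m : ℕ) {k : ℕ} (hk : k < m) :
    (greedyBitsP pot m).take (k + 1) = greedyStepP pot ((greedyBitsP pot m).take k) := by
  unfold greedyBitsP
  have hsplit : ∀ i, i ≤ m → List.replicate m () = List.replicate i () ++ List.replicate (m - i) () := fun i hi => by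
    rw [← List.replicate_add]; congr 1; omega
  have h1 : (greedyRunP pot (List.replicate m ())).take (k + 1) = greedyRunP pot (List.replicate (k + 1) ()) := by
    have := greedyRunP_prefix pot (List.replicate (m - (k + 1)) ()) (List.replicate (k + 1) ())
    rw [List.length_replicate, ← hsplit (k + 1) hk] at this
    exact this
  have h2 : (greedyRunP pot (List.replicate m ())).take k = greedyRunP pot (List.replicate k ()) := by
    have := greedyRunP_prefix pot (List.replicate (m - k) ()) (List.replicate k ())
    rw [List.length_replicate, ← hsplit k hk.le] at this
    exact this
  rw [h1, h2, List.replicate_succ', greedyRunP_append]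
  simp

/-- **THE GREEDY CHOICE**: at every step the chosen bit's cylinder has potential at most the sibling's. -/
theorem pot_greedyStepP_le (acc : List Bool) :
    ∃ b, greedyStepP pot acc = acc ++ [b] ∧
      pot (acc.length + 1) (acc ++ [b]) ≤ pot (acc.length + 1) (acc ++ [!b]) := by
  unfold greedyStepP
  split_ifs with h
  · exact ⟨false, rfl, h⟩
  · exact ⟨true, rfl, (not_le.1 h).le⟩

end Loop

end Summit.PneNP.PneNP.Theorems.Sd2BlMachine
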